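import Mathlib

/-!
# Crux `UniformPhotonSphereChannelsR` (K1R, stmt-FinalStateConjecture-14074), line
# `crum-peeling-recessive-tower` — stub (A2b): chain bookkeeping

The registered stub `stub_chainBookkeeping` of the line's skeleton (continuation lead c2).  The
uniform majorant induction along the recessive Riccati–Crum chain carries, at rung `k` of a
ladder of height `ℓ` (`λ = ℓ - k ≥ 1` the residual angular momentum), a radius
`B_k = 16 + Σ_{j<k} Δ_{ℓ-j}` with the shift `Δ_λ = (2λ-1)/(λ(λ-1)) = 1/λ + 1/(λ-1)`, and an angle
`θ_k = 2⁻¹⁰ ∏_{j<k} (1 - 2/(2(ℓ-j)-1)²)`.  This file proves the three elementary bookkeeping facts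
the export needs:

* (P1) the angle product never drops below `4/9`: by Weierstrass' product inequality
  `∏ (1 - x_j) ≥ 1 - Σ x_j` and the telescoping majorant `2/(2λ-1)² ≤ 1/(2(λ-1)) - 1/(2λ)`, the
  decrements sum to at most `1/(2(ℓ-k)) - 1/(2ℓ) ≤ 1/2`;
* (P2) the total shift is logarithmic, `Σ_{j<k} Δ_{ℓ-j} ≤ 1 + 2 log ℓ`: termwise
  `Δ_λ = 2/λ + (1/(λ-1) - 1/λ) ≤ 2 (log λ - log (λ-1)) + (1/(λ-1) - 1/λ)` (from
  `log (1 - 1/λ) ≤ -1/λ`), and both majorants telescope in `j`;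
* (P3) the inversion majorant: if `g = Σ G n wⁿ` has `G 0 = 1`, `|G n| ≤ Aⁿ` (`n ≥ 1`, `A ≥ 1`) and
  `ω = Σ Ω n wⁿ` is its formal inverse (`Σ_{i≤n} G i Ω (n-i) = [n = 0]`), then `|Ω n| ≤ (2A)ⁿ`, by
  strong induction from `Ω n = -Σ_{i=1}^{n} G i Ω (n-i)` and
  `Σ_{i<n} A^{i+1} (2A)^{n-1-i} = (2A)ⁿ - Aⁿ`.
-/

-- `Summit.<S>.<S>` repeats a namespace component by design (D-0017); off here as in the lakefile.
set_option linter.dupNamespace false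

noncomputable section

namespace Summit.FinalStateConjecture.FinalStateConjecture.Theorems.CrumPeelingRecessiveTower

/-- **Weierstrass' product inequality** on `range k`: `1 - Σ_{j<k} x_j ≤ ∏_{j<k} (1 - x_j)` for
decrements `x_j ∈ [0, 1]`. -/
theorem chainBookkeeping_one_sub_sum_le_prod (x : ℕ → ℝ) (k : ℕ)
    (h0 : ∀ j < k, 0 ≤ x j) (h1 : ∀ j < k, x j ≤ 1) :
    1 - ∑ j ∈ Finset.range k, x j ≤ ∏ j ∈ Finset.range k, (1 - x j) := by
  induction k with
  | zero => simp
  | succ k ih =>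
    rw [Finset.sum_range_succ, Finset.prod_range_succ]
    have hP0 : 0 ≤ ∏ j ∈ Finset.range k, (1 - x j) :=
      Finset.prod_nonneg fun j hj => sub_nonneg.2 (h1 j (by have := Finset.mem_range.1 hj; omega))
    have hP1 : ∏ j ∈ Finset.range k, (1 - x j) ≤ 1 :=
      Finset.prod_le_one
        (fun j hj => sub_nonneg.2 (h1 j (by have := Finset.mem_range.1 hj; omega)))
        fun j hj => by linarith [h0 j (by have := Finset.mem_range.1 hj; omega)]
    have hih := ih (fun j hj => h0 j (by omega)) fun j hj => h1 j (by omega)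
    have ha0 := h0 k (by omega)
    have ha1 := h1 k (by omega)
    nlinarith [mul_nonneg (sub_nonneg.2 hP1) ha0]

/-- For `j < k ≤ ℓ - 1` the residual angular momentum `λ = ℓ - j` of rung `j` is at least `2`. -/
theorem chainBookkeeping_two_le (ℓ k : ℕ) (hk : k + 1 ≤ ℓ) (j : ℕ) (hj : j < k) :
    (2 : ℝ) ≤ (ℓ : ℝ) - j := by
  have h : j + 2 ≤ ℓ := by omega
  have h' : ((j : ℝ) + 2 ≤ (ℓ : ℝ)) := by exact_mod_cast h
  linarith

/-- The angle decrement of one rung against a telescoping majorant: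
`2/(2λ-1)² ≤ 1/(2(λ-1)) - 1/(2λ)` (`= 1/(2λ(λ-1))`) for `λ ≥ 2`. -/
theorem chainBookkeeping_thetaTerm_le (t : ℝ) (ht : 2 ≤ t) :
    2 / (2 * t - 1) ^ 2 ≤ 1 / (2 * (t - 1)) - 1 / (2 * t) := by
  have h1 : 0 < t - 1 := by linarith
  have h2 : 0 < t := by linarith
  have h3 : 0 < 2 * t - 1 := by linarith
  rw [div_sub_div _ _ (by positivity) (by positivity),
    div_le_div_iff₀ (by positivity) (by positivity)]
  nlinarith

/-- **(P1) The angle product stays above `4/9`.**  For `k + 1 ≤ ℓ`,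
`4/9 ≤ ∏_{j<k} (1 - 2/(2(ℓ-j)-1)²)`; in fact the product is at least `1/2`, since the decrements
telescope: `Σ_{j<k} 2/(2(ℓ-j)-1)² ≤ 1/(2(ℓ-k)) - 1/(2ℓ) ≤ 1/2`. -/
theorem chainBookkeeping_thetaProd (ℓ k : ℕ) (hk : k + 1 ≤ ℓ) :
    (4 : ℝ) / 9 ≤ ∏ j ∈ Finset.range k, (1 - 2 / (2 * ((ℓ : ℝ) - j) - 1) ^ 2) := by
  have hlam := chainBookkeeping_two_le ℓ k hk
  -- Weierstrass: the product dominates `1 - Σ (decrements)`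
  have hW := chainBookkeeping_one_sub_sum_le_prod (fun j => 2 / (2 * ((ℓ : ℝ) - j) - 1) ^ 2) k
    (fun j _ => by positivity) (fun j hj => by
      have h := hlam j hj
      rw [div_le_one (by nlinarith)]
      nlinarith)
  -- the decrements telescope below `1/2`
  have hle : ∑ j ∈ Finset.range k, 2 / (2 * ((ℓ : ℝ) - j) - 1) ^ 2
      ≤ ∑ j ∈ Finset.range k,
          (1 / (2 * ((ℓ : ℝ) - ((j + 1 : ℕ) : ℝ))) - 1 / (2 * ((ℓ : ℝ) - (j : ℕ)))) := by
    refine Finset.sum_le_sum fun j hj => ?_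
    have h := chainBookkeeping_thetaTerm_le ((ℓ : ℝ) - j) (hlam j (Finset.mem_range.1 hj))
    have e : (ℓ : ℝ) - ((j + 1 : ℕ) : ℝ) = (ℓ : ℝ) - j - 1 := by push_cast; ring
    rw [e]
    exact h
  have htel : ∑ j ∈ Finset.range k,
      (1 / (2 * ((ℓ : ℝ) - ((j + 1 : ℕ) : ℝ))) - 1 / (2 * ((ℓ : ℝ) - (j : ℕ))))
      = 1 / (2 * ((ℓ : ℝ) - (k : ℕ))) - 1 / (2 * ((ℓ : ℝ) - ((0 : ℕ) : ℝ))) :=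
    Finset.sum_range_sub (fun j => 1 / (2 * ((ℓ : ℝ) - (j : ℕ)))) k
  rw [htel, Nat.cast_zero, sub_zero] at hle
  have hℓk : (1 : ℝ) ≤ (ℓ : ℝ) - k := by
    have : ((k : ℝ) + 1 ≤ (ℓ : ℝ)) := by exact_mod_cast hk
    linarith
  have hgk : 1 / (2 * ((ℓ : ℝ) - k)) ≤ 1 / 2 :=
    one_div_le_one_div_of_le (by norm_num) (by linarith)
  have hg0 : (0 : ℝ) ≤ 1 / (2 * (ℓ : ℝ)) := by positivity
  have hS : ∑ j ∈ Finset.range k, 2 / (2 * ((ℓ : ℝ) - j) - 1) ^ 2 ≤ 1 / 2 := by linarith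
  calc (4 : ℝ) / 9 ≤ 1 - ∑ j ∈ Finset.range k, 2 / (2 * ((ℓ : ℝ) - j) - 1) ^ 2 := by linarith
    _ ≤ _ := hW

/-- One shift `Δ_λ = (2λ-1)/(λ(λ-1)) = 2/λ + (1/(λ-1) - 1/λ)` against telescoping majorants:
`Δ_λ ≤ 2 (log λ - log (λ-1)) + (1/(λ-1) - 1/λ)` for `λ ≥ 2`, since
`log (λ-1) - log λ = log ((λ-1)/λ) ≤ (λ-1)/λ - 1 = -1/λ`. -/
theorem chainBookkeeping_shiftTerm_le (t : ℝ) (ht : 2 ≤ t) :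
    (2 * t - 1) / (t * (t - 1)) ≤
      2 * (Real.log t - Real.log (t - 1)) + (1 / (t - 1) - 1 / t) := by
  have h1 : 0 < t - 1 := by linarith
  have h2 : 0 < t := by linarith
  have ht0 : t ≠ 0 := h2.ne'
  have ht1 : t - 1 ≠ 0 := h1.ne'
  -- `log ((t-1)/t) ≤ (t-1)/t - 1 = -1/t`
  have hlog : Real.log (t - 1) - Real.log t ≤ -(1 / t) := by
    have h := Real.log_le_sub_one_of_pos (div_pos h1 h2)
    rw [Real.log_div ht1 ht0] at h
    have e : (t - 1) / t - 1 = -(1 / t) := by field_simp; ring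
    linarith [e.le, e.ge]
  have e2 : (2 * t - 1) / (t * (t - 1)) = 2 * (1 / t) + (1 / (t - 1) - 1 / t) := by
    field_simp; ring
  rw [e2]
  linarith

/-- **(P2) The total shift is logarithmic.**  For `k + 1 ≤ ℓ`,
`Σ_{j<k} (2(ℓ-j)-1)/((ℓ-j)(ℓ-j-1)) ≤ 1 + 2 log ℓ`: summing the termwise majorant of
`chainBookkeeping_shiftTerm_le`, both parts telescope in `j`, to
`2 (log ℓ - log (ℓ-k)) + (1/(ℓ-k) - 1/ℓ) ≤ 2 log ℓ + 1` (`ℓ - k ≥ 1`). -/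
theorem chainBookkeeping_shiftSum (ℓ k : ℕ) (hk : k + 1 ≤ ℓ) :
    ∑ j ∈ Finset.range k, (2 * ((ℓ : ℝ) - j) - 1) / (((ℓ : ℝ) - j) * (((ℓ : ℝ) - j) - 1))
      ≤ 1 + 2 * Real.log ℓ := by
  have hlam := chainBookkeeping_two_le ℓ k hk
  -- termwise majorant
  have hle : ∑ j ∈ Finset.range k, (2 * ((ℓ : ℝ) - j) - 1) / (((ℓ : ℝ) - j) * (((ℓ : ℝ) - j) - 1))
      ≤ ∑ j ∈ Finset.range k,
          (2 * (Real.log ((ℓ : ℝ) - (j : ℕ)) - Real.log ((ℓ : ℝ) - ((j + 1 : ℕ) : ℝ)))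
            + (1 / ((ℓ : ℝ) - ((j + 1 : ℕ) : ℝ)) - 1 / ((ℓ : ℝ) - (j : ℕ)))) := by
    refine Finset.sum_le_sum fun j hj => ?_
    have h := chainBookkeeping_shiftTerm_le ((ℓ : ℝ) - j) (hlam j (Finset.mem_range.1 hj))
    have e : (ℓ : ℝ) - ((j + 1 : ℕ) : ℝ) = (ℓ : ℝ) - j - 1 := by push_cast; ring
    rw [e]
    exact h
  -- both majorants telescope
  have ht1 : ∑ j ∈ Finset.range k,
      (Real.log ((ℓ : ℝ) - (j : ℕ)) - Real.log ((ℓ : ℝ) - ((j + 1 : ℕ) : ℝ)))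
      = Real.log ((ℓ : ℝ) - ((0 : ℕ) : ℝ)) - Real.log ((ℓ : ℝ) - (k : ℕ)) :=
    Finset.sum_range_sub' (fun j => Real.log ((ℓ : ℝ) - (j : ℕ))) k
  have ht2 : ∑ j ∈ Finset.range k,
      (1 / ((ℓ : ℝ) - ((j + 1 : ℕ) : ℝ)) - 1 / ((ℓ : ℝ) - (j : ℕ)))
      = 1 / ((ℓ : ℝ) - (k : ℕ)) - 1 / ((ℓ : ℝ) - ((0 : ℕ) : ℝ)) :=
    Finset.sum_range_sub (fun j => 1 / ((ℓ : ℝ) - (j : ℕ))) k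
  rw [Finset.sum_add_distrib, ← Finset.mul_sum, ht1, ht2, Nat.cast_zero, sub_zero] at hle
  have hℓk : (1 : ℝ) ≤ (ℓ : ℝ) - k := by
    have : ((k : ℝ) + 1 ≤ (ℓ : ℝ)) := by exact_mod_cast hk
    linarith
  have hlogk : 0 ≤ Real.log ((ℓ : ℝ) - k) := Real.log_nonneg hℓk
  have hinv : 1 / ((ℓ : ℝ) - k) ≤ 1 := by
    rw [div_le_one (by linarith)]
    exact hℓk
  have hℓinv : (0 : ℝ) ≤ 1 / (ℓ : ℝ) := by positivity
  linarith

/-- The weighted geometric sum behind the inversion majorant: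
`Σ_{i<n} A^{i+1} (2A)^{n-(i+1)} + Aⁿ = (2A)ⁿ`. -/
theorem chainBookkeeping_geomIdentity (A : ℝ) (n : ℕ) :
    ∑ i ∈ Finset.range n, A ^ (i + 1) * (2 * A) ^ (n - (i + 1)) + A ^ n = (2 * A) ^ n := by
  induction n with
  | zero => simp
  | succ n ih =>
    rw [Finset.sum_range_succ]
    have h : ∑ i ∈ Finset.range n, A ^ (i + 1) * (2 * A) ^ (n + 1 - (i + 1))
        = 2 * A * ∑ i ∈ Finset.range n, A ^ (i + 1) * (2 * A) ^ (n - (i + 1)) := by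
      rw [Finset.mul_sum]
      refine Finset.sum_congr rfl fun i hi => ?_
      have hi' := Finset.mem_range.1 hi
      have e : n + 1 - (i + 1) = (n - (i + 1)) + 1 := by omega
      rw [e, pow_succ]
      ring
    have e2 : n + 1 - (n + 1) = 0 := Nat.sub_self _
    rw [h, e2, pow_zero, mul_one]
    have hS : ∑ i ∈ Finset.range n, A ^ (i + 1) * (2 * A) ^ (n - (i + 1))
        = (2 * A) ^ n - A ^ n := by linarith
    rw [hS]
    ring

/-- **(P3) The inversion majorant.**  If `G 0 = Ω 0 = 1`, `|G n| ≤ Aⁿ` for `n ≥ 1` (`A ≥ 1`) and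
`Σ_{i≤n} G i Ω (n-i) = [n = 0]` (so `ω = Σ Ω n wⁿ` is the formal inverse of `g = Σ G n wⁿ`), then
`|Ω n| ≤ (2A)ⁿ`: peel `i = 0` to get `Ω n = -Σ_{i<n} G (i+1) Ω (n-(i+1))` and use strong
induction with `Σ_{i<n} A^{i+1} (2A)^{n-(i+1)} = (2A)ⁿ - Aⁿ ≤ (2A)ⁿ`. -/
theorem chainBookkeeping_inversionMajorant (G Ω : ℕ → ℝ) (A : ℝ) (hA : 1 ≤ A) (hG0 : G 0 = 1)
    (hΩ0 : Ω 0 = 1) (hG : ∀ n, 1 ≤ n → |G n| ≤ A ^ n)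
    (hconv : ∀ n, ∑ i ∈ Finset.range (n + 1), G i * Ω (n - i) = if n = 0 then 1 else 0) :
    ∀ n, |Ω n| ≤ (2 * A) ^ n := by
  have hA0 : 0 ≤ A := by linarith
  intro n
  refine Nat.strong_induction_on n fun n ih => ?_
  rcases Nat.eq_zero_or_pos n with rfl | hn
  · simp [hΩ0]
  · -- peel off the `i = 0` term of the convolution identity at order `n ≥ 1`
    have h := hconv n
    rw [if_neg hn.ne', Finset.sum_range_succ', hG0, Nat.sub_zero, one_mul] at h
    have hΩn : Ω n = -∑ i ∈ Finset.range n, G (i + 1) * Ω (n - (i + 1)) := by linarith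
    rw [hΩn, abs_neg]
    calc |∑ i ∈ Finset.range n, G (i + 1) * Ω (n - (i + 1))|
        ≤ ∑ i ∈ Finset.range n, |G (i + 1) * Ω (n - (i + 1))| := Finset.abs_sum_le_sum_abs _ _
      _ ≤ ∑ i ∈ Finset.range n, A ^ (i + 1) * (2 * A) ^ (n - (i + 1)) := by
          refine Finset.sum_le_sum fun i hi => ?_
          have hi' := Finset.mem_range.1 hi
          rw [abs_mul]
          exact mul_le_mul (hG (i + 1) (by omega)) (ih _ (by omega)) (abs_nonneg _)
            (pow_nonneg hA0 _)
      _ ≤ (2 * A) ^ n := by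
          have hid := chainBookkeeping_geomIdentity A n
          have hAn : 0 ≤ A ^ n := pow_nonneg hA0 _
          linarith

/-- **Stub (A2b) `stub_chainBookkeeping` — the chain bookkeeping of the uniform majorant induction
(registered signature).**  (P1) the angle product `∏_{j<k} (1 - 2/(2(ℓ-j)-1)²)` stays `≥ 4/9`
for `k + 1 ≤ ℓ`; (P2) the total shift `Σ_{j<k} (2(ℓ-j)-1)/((ℓ-j)(ℓ-j-1))` is `≤ 1 + 2 log ℓ`;
(P3) the inversion majorant `|G n| ≤ Aⁿ (n ≥ 1), G 0 = Ω 0 = 1, Σ_{i≤n} G i Ω (n-i) = [n = 0]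
⟹ |Ω n| ≤ (2A)ⁿ`. -/
theorem stub_chainBookkeeping :
    (∀ (ℓ k : ℕ), k + 1 ≤ ℓ →
        (4 : ℝ) / 9 ≤ ∏ j ∈ Finset.range k, (1 - 2 / (2 * ((ℓ : ℝ) - j) - 1) ^ 2)) ∧
    (∀ (ℓ k : ℕ), k + 1 ≤ ℓ →
        ∑ j ∈ Finset.range k, (2 * ((ℓ : ℝ) - j) - 1) / (((ℓ : ℝ) - j) * (((ℓ : ℝ) - j) - 1))
          ≤ 1 + 2 * Real.log ℓ) ∧
    (∀ (G Ω : ℕ → ℝ) (A : ℝ), 1 ≤ A → G 0 = 1 → Ω 0 = 1 → (∀ n, 1 ≤ n → |G n| ≤ A ^ n) →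
        (∀ n, ∑ i ∈ Finset.range (n + 1), G i * Ω (n - i) = if n = 0 then 1 else 0) →
        ∀ n, |Ω n| ≤ (2 * A) ^ n) :=
  ⟨chainBookkeeping_thetaProd, chainBookkeeping_shiftSum, chainBookkeeping_inversionMajorant⟩

end Summit.FinalStateConjecture.FinalStateConjecture.Theorems.CrumPeelingRecessiveTower

end
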